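import Summits.KontsevichZagierPeriods.KontsevichZagierPeriods.Theorems.LinRedNormalFormArrangementNormalFormSeparateTwoHIRayMain
import Summits.KontsevichZagierPeriods.KontsevichZagierPeriods.Theorems.LinRedNormalFormArrangementNormalFormSeparateTwoHIWeight

/-!
# The Taylor pieces on one thin sector: from the ray theorems to the sector integral

(Line `janus-bands`, crux `ArrangementNormalForm`, stub `stub_separateTwoPos_hI`, part `HISector`.)
The measure-theoretic assembly around the ray theorems of part `HIRayMain`. On the base plane
let `Y` be the open base polygon, `m` the fibre mass, `R` the base factor of the integrand and
`Ri i` (`i < N`) the base factors of the Taylor pieces; the density to be shown locally finite is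
`g = 𝟙_Y · (∑_{i<N} |Ri i|) · m`. For a thin sector at `z₁` with frame `P, Q` (part `HIChart`):
* `sector_zero`: if the open sector misses `Y`, `∫⁻_{sector [0,ε)} g = 0`;
* `sector_finite`: if the open sector lies in `Y` and every piece is finite in blown-up
  coordinates, `∫⁻_{t<δ} ∫⁻_{v<ε} t |Ri i(bpt)| m(bpt) < ∞`, then `∫⁻_{sector [0,ε)} g < ∞`;
* `hfin_of_inside`: if the open sector at scale `(4δ, 4ε)` lies in `Y`, the global finiteness
  `∫⁻_Y |R| m < ∞` gives `∫⁻_{t<4δ} ∫⁻_{v<4ε} t |R(bpt)| m(bpt) < ∞`;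
* `step_pole`, `step_away`: the passage between `t |R(bpt)| m(bpt)` and `|usum| · wt`
  (`piece_eq_wt`, `piece_le_wt`) that feeds the ray theorems and reads off their conclusions.
Registered in literal form as `separateTwo_hiSector` (= `sector_finite`).
-/

noncomputable section

open Set MeasureTheory
open scoped ENNReal

namespace Summit.KontsevichZagierPeriods.ArrangementNormalForm.JanusBands

namespace SepTwo

variable (Y : Set (Fin 2 → ℝ)) (m : (Fin 2 → ℝ) → ℝ≥0∞) (Ri : ℕ → (Fin 2 → ℝ) → ℝ) (N : ℕ)
  (z₁ P Q : Fin 2 → ℝ)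

/-! ### Pointwise conversions -/

/-- `t · |num/den| · Λ = |U| · (t/X) · Λ` for `|num| = |U|`, `|den| = X > 0`. -/
theorem piece_eq_wt {t : ℝ} (ht : 0 ≤ t) {num den U X : ℝ} (hnum : |num| = |U|) (hden : |den| = X)
    (hX : 0 < X) (Λ : ℝ≥0∞) :
    ENNReal.ofReal t * (ENNReal.ofReal |num / den| * Λ) =
      ENNReal.ofReal |U| * (ENNReal.ofReal (t / X) * Λ) := by
  rw [abs_div, hnum, hden, ← mul_assoc, ← mul_assoc, ← ENNReal.ofReal_mul ht,
    ← ENNReal.ofReal_mul (abs_nonneg _)]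
  congr 2
  field_simp

/-- `t · |num/den| · Λ ≤ C · (t/X) · Λ` for `|num| ≤ C`, `|den| = X > 0`. -/
theorem piece_le_wt {t : ℝ} (ht : 0 ≤ t) {num den C X : ℝ} (hnum : |num| ≤ C)
    (hden : |den| = X) (hX : 0 < X) (Λ : ℝ≥0∞) :
    ENNReal.ofReal t * (ENNReal.ofReal |num / den| * Λ) ≤
      ENNReal.ofReal C * (ENNReal.ofReal (t / X) * Λ) := by
  have hC : 0 ≤ C := (abs_nonneg _).trans hnum
  rw [abs_div, hden, ← mul_assoc, ← mul_assoc, ← ENNReal.ofReal_mul ht,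
    ← ENNReal.ofReal_mul hC]
  refine mul_le_mul_left (ENNReal.ofReal_le_ofReal ?_) _
  rw [← mul_div_assoc, ← mul_div_assoc, mul_comm C]
  exact div_le_div_of_nonneg_right (mul_le_mul_of_nonneg_left hnum ht) hX.le

/-! ### Measurability -/

/-- The blow-up point is jointly measurable. -/
theorem measurable_bpt : Measurable fun p : ℝ × ℝ => bpt z₁ P Q p.1 p.2 :=
  (continuous_bpt z₁ P Q).measurable

variable {m Ri}

/-- The piece integrand in blown-up coordinates is jointly measurable. -/
theorem measurable_piece_bpt (hm : Measurable m) (hRi : ∀ i, Measurable (Ri i)) (i : ℕ) :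
    Measurable (Function.uncurry fun t v => ENNReal.ofReal t *
      (ENNReal.ofReal |Ri i (bpt z₁ P Q t v)| * m (bpt z₁ P Q t v))) := by
  have h1 : Measurable fun p : ℝ × ℝ => ENNReal.ofReal |Ri i (bpt z₁ P Q p.1 p.2)| :=
    ENNReal.measurable_ofReal.comp (continuous_abs.measurable.comp ((hRi i).comp
      (measurable_bpt z₁ P Q)))
  exact (ENNReal.measurable_ofReal.comp measurable_fst).mul (h1.mul (hm.comp (measurable_bpt z₁ P Q)))

variable {Y}

/-- The density `g` is measurable. -/
theorem measurable_g (hY : MeasurableSet Y) (hm : Measurable m) (hRi : ∀ i, Measurable (Ri i)) :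
    Measurable fun x => Y.indicator (fun x => (∑ i ∈ Finset.range N, ENNReal.ofReal |Ri i x|) * m x) x := by
  refine Measurable.indicator ?_ hY
  refine Measurable.mul (Finset.measurable_sum _ fun i _ => ?_) hm
  exact ENNReal.measurable_ofReal.comp (continuous_abs.measurable.comp (hRi i))

/-! ### The sector integral -/

/-- **A sector missing the base polygon carries no mass.** -/
theorem sector_zero (hY : MeasurableSet Y) (hm : Measurable m) (hRi : ∀ i, Measurable (Ri i))
    (hdet : P 0 * Q 1 - Q 0 * P 1 ≠ 0) {δ ε : ℝ}
    (hout : ∀ t ∈ Ioo (0 : ℝ) δ, ∀ v ∈ Ioo (0 : ℝ) ε, bpt z₁ P Q t v ∉ Y) :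
    ∫⁻ z in sector z₁ P Q δ (Ico 0 ε),
      Y.indicator (fun x => (∑ i ∈ Finset.range N, ENNReal.ofReal |Ri i x|) * m x) z = 0 := by
  rw [lintegral_sector_Ico z₁ P Q hdet δ ε _ (measurable_g N hY hm hRi)]
  have h : ∀ t ∈ Ioo (0 : ℝ) δ, ENNReal.ofReal t * ∫⁻ v in Ioo 0 ε, Y.indicator
      (fun x => (∑ i ∈ Finset.range N, ENNReal.ofReal |Ri i x|) * m x) (bpt z₁ P Q t v) = 0 := by
    intro t ht
    rw [setLIntegral_congr_fun measurableSet_Ioo fun v hv => indicator_of_notMem (hout t ht v hv) _]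
    simp
  rw [setLIntegral_congr_fun measurableSet_Ioo h]
  simp

/-- **A sector inside the base polygon: finiteness from the pieces in blown-up coordinates.** -/
theorem sector_finite (hY : MeasurableSet Y) (hm : Measurable m) (hRi : ∀ i, Measurable (Ri i))
    (hdet : P 0 * Q 1 - Q 0 * P 1 ≠ 0) {δ ε : ℝ}
    (hin : ∀ t ∈ Ioo (0 : ℝ) δ, ∀ v ∈ Ioo (0 : ℝ) ε, bpt z₁ P Q t v ∈ Y)
    (hpieces : ∀ i ∈ Finset.range N, ∫⁻ t in Ioo 0 δ, ∫⁻ v in Ioo 0 ε, ENNReal.ofReal t *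
      (ENNReal.ofReal |Ri i (bpt z₁ P Q t v)| * m (bpt z₁ P Q t v)) < ∞) :
    ∫⁻ z in sector z₁ P Q δ (Ico 0 ε),
      Y.indicator (fun x => (∑ i ∈ Finset.range N, ENNReal.ofReal |Ri i x|) * m x) z < ∞ := by
  rw [lintegral_sector_Ico z₁ P Q hdet δ ε _ (measurable_g N hY hm hRi)]
  refine ENNReal.mul_lt_top ENNReal.ofReal_lt_top ?_
  have h : ∀ t ∈ Ioo (0 : ℝ) δ, ENNReal.ofReal t * ∫⁻ v in Ioo 0 ε, Y.indicator
      (fun x => (∑ i ∈ Finset.range N, ENNReal.ofReal |Ri i x|) * m x) (bpt z₁ P Q t v) =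
      ∫⁻ v in Ioo 0 ε, ∑ i ∈ Finset.range N, ENNReal.ofReal t *
        (ENNReal.ofReal |Ri i (bpt z₁ P Q t v)| * m (bpt z₁ P Q t v)) := by
    intro t ht
    rw [setLIntegral_congr_fun measurableSet_Ioo fun v hv => indicator_of_mem (hin t ht v hv) _,
      ← lintegral_const_mul']
    · refine lintegral_congr fun v => ?_
      rw [Finset.sum_mul, Finset.mul_sum]
    · exact ENNReal.ofReal_ne_top
  rw [setLIntegral_congr_fun measurableSet_Ioo h, lintegral₂_finset_sum _ _
    (fun i _ => measurable_piece_bpt z₁ P Q hm hRi i)]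
  exact ENNReal.sum_lt_top.2 hpieces

/-- **The finiteness hypothesis of the ray theorems from the global finiteness.** -/
theorem hfin_of_inside (hm : Measurable m) {R : (Fin 2 → ℝ) → ℝ}
    (hR : Measurable R) (hfinY : ∫⁻ x in Y, ENNReal.ofReal |R x| * m x < ∞)
    (hdet : P 0 * Q 1 - Q 0 * P 1 ≠ 0) {δ ε : ℝ}
    (hin : ∀ t ∈ Ioo (0 : ℝ) δ, ∀ v ∈ Ioo (0 : ℝ) ε, bpt z₁ P Q t v ∈ Y) :
    ∫⁻ t in Ioo 0 δ, ∫⁻ v in Ioo 0 ε, ENNReal.ofReal t *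
      (ENNReal.ofReal |R (bpt z₁ P Q t v)| * m (bpt z₁ P Q t v)) < ∞ := by
  have hsub : sector z₁ P Q δ (Ioo 0 ε) ⊆ Y := fun z hz => by
    obtain ⟨t, ht, v, hv, rfl⟩ := (mem_sector_iff z₁ P Q δ _ z).1 hz
    exact hin t ht v hv
  have hGm : Measurable fun x => ENNReal.ofReal |R x| * m x :=
    (ENNReal.measurable_ofReal.comp (continuous_abs.measurable.comp hR)).mul hm
  have h1 := (lintegral_mono_set (μ := volume) (f := fun x => ENNReal.ofReal |R x| * m x)
    hsub).trans_lt hfinY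
  rw [lintegral_sector z₁ P Q hdet δ measurableSet_Ioo _ hGm] at h1
  have h2 : ∫⁻ t in Ioo 0 δ, ENNReal.ofReal t * ∫⁻ v in Ioo 0 ε,
      ENNReal.ofReal |R (bpt z₁ P Q t v)| * m (bpt z₁ P Q t v) < ∞ := by
    rcases ENNReal.mul_lt_top_iff.1 h1 with ⟨-, h⟩ | h | h
    · exact h
    · exact absurd (ENNReal.ofReal_eq_zero.1 h) (not_le.2 (abs_pos.2 hdet))
    · rw [h]; exact ENNReal.zero_lt_top
  convert h2 using 1
  exact lintegral_congr fun t => lintegral_const_mul' _ _ ENNReal.ofReal_ne_top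

/-! ### The two steps -/

/-- **Pole step.** If `t |R(bpt)| m(bpt) = |usum T| · wt` on the big sector and
`t |Ri i (bpt)| m(bpt) = |usum Tᵢ| · wt` on the small one, a ray theorem of part `HIRayMain`
(`ray_pole_zero` / `ray_pole_order`, passed as `hray`) turns the finiteness hypothesis into the
finiteness of every piece. -/
theorem step_pole (T : Finset (ℕ × ℕ)) (κ : ℕ × ℕ → ℝ) (π : ℕ × ℕ → ℕ) (D M : ℕ) (s σ : ℝ)
    (ω : ℝ → ℝ → ℝ) (Λ' : ℝ → ℝ → ℝ≥0∞) {R : (Fin 2 → ℝ) → ℝ} {δ ε : ℝ}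
    (hR : ∀ t ∈ Ioo (0 : ℝ) (4 * δ), ∀ v ∈ Ioo (0 : ℝ) (4 * ε),
      ENNReal.ofReal t * (ENNReal.ofReal |R (bpt z₁ P Q t v)| * m (bpt z₁ P Q t v)) =
        ENNReal.ofReal |usum T κ π t (s + σ * v)| * wt D M s σ ω Λ' t v)
    (hRi : ∀ i ∈ Finset.range N, ∀ t ∈ Ioo (0 : ℝ) δ, ∀ v ∈ Ioo (0 : ℝ) ε,
      ENNReal.ofReal t * (ENNReal.ofReal |Ri i (bpt z₁ P Q t v)| * m (bpt z₁ P Q t v)) =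
        ENNReal.ofReal |usum (T.filter fun im => im.1 = i) κ π t (s + σ * v)| *
          wt D M s σ ω Λ' t v)
    (hray : ∫⁻ t in Ioo 0 (4 * δ), ∫⁻ v in Ioo 0 (4 * ε),
        ENNReal.ofReal |usum T κ π t (s + σ * v)| * wt D M s σ ω Λ' t v < ∞ →
      ∀ i : ℕ, ∫⁻ t in Ioo 0 δ, ∫⁻ v in Ioo 0 ε, ENNReal.ofReal
        |usum (T.filter fun im => im.1 = i) κ π t (s + σ * v)| * wt D M s σ ω Λ' t v < ∞)
    (hfin : ∫⁻ t in Ioo 0 (4 * δ), ∫⁻ v in Ioo 0 (4 * ε), ENNReal.ofReal t *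
      (ENNReal.ofReal |R (bpt z₁ P Q t v)| * m (bpt z₁ P Q t v)) < ∞) :
    ∀ i ∈ Finset.range N, ∫⁻ t in Ioo 0 δ, ∫⁻ v in Ioo 0 ε, ENNReal.ofReal t *
      (ENNReal.ofReal |Ri i (bpt z₁ P Q t v)| * m (bpt z₁ P Q t v)) < ∞ := by
  intro i hi
  rw [setLIntegral_congr_fun measurableSet_Ioo fun t ht =>
    setLIntegral_congr_fun measurableSet_Ioo fun v hv => hR t ht v hv] at hfin
  rw [setLIntegral_congr_fun measurableSet_Ioo fun t ht =>
    setLIntegral_congr_fun measurableSet_Ioo fun v hv => hRi i hi t ht v hv]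
  exact hray hfin i

/-- **Away step.** If `t |R(bpt)| m(bpt) = |usum T| · wt` on the big sector and every piece is
`≤ C · wt` on the small one, the ray theorem `ray_away` (passed as `hray`: the weight itself is
integrable) gives the finiteness of every piece. -/
theorem step_away (T : Finset (ℕ × ℕ)) (κ : ℕ × ℕ → ℝ) (π : ℕ × ℕ → ℕ) (s σ : ℝ)
    (ω : ℝ → ℝ → ℝ) (Λ' : ℝ → ℝ → ℝ≥0∞) {R : (Fin 2 → ℝ) → ℝ} {δ ε : ℝ} (C : ℝ≥0∞) (hC : C ≠ ∞)
    (hR : ∀ t ∈ Ioo (0 : ℝ) (4 * δ), ∀ v ∈ Ioo (0 : ℝ) (4 * ε),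
      ENNReal.ofReal t * (ENNReal.ofReal |R (bpt z₁ P Q t v)| * m (bpt z₁ P Q t v)) =
        ENNReal.ofReal |usum T κ π t (s + σ * v)| * wt 0 0 s σ ω Λ' t v)
    (hRi : ∀ i ∈ Finset.range N, ∀ t ∈ Ioo (0 : ℝ) δ, ∀ v ∈ Ioo (0 : ℝ) ε,
      ENNReal.ofReal t * (ENNReal.ofReal |Ri i (bpt z₁ P Q t v)| * m (bpt z₁ P Q t v)) ≤
        C * wt 0 0 s σ ω Λ' t v)
    (hray : ∫⁻ t in Ioo 0 (4 * δ), ∫⁻ v in Ioo 0 (4 * ε),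
        ENNReal.ofReal |usum T κ π t (s + σ * v)| * wt 0 0 s σ ω Λ' t v < ∞ →
      ∫⁻ t in Ioo 0 δ, ∫⁻ v in Ioo 0 ε, wt 0 0 s σ ω Λ' t v < ∞)
    (hfin : ∫⁻ t in Ioo 0 (4 * δ), ∫⁻ v in Ioo 0 (4 * ε), ENNReal.ofReal t *
      (ENNReal.ofReal |R (bpt z₁ P Q t v)| * m (bpt z₁ P Q t v)) < ∞) :
    ∀ i ∈ Finset.range N, ∫⁻ t in Ioo 0 δ, ∫⁻ v in Ioo 0 ε, ENNReal.ofReal t *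
      (ENNReal.ofReal |Ri i (bpt z₁ P Q t v)| * m (bpt z₁ P Q t v)) < ∞ := by
  intro i hi
  rw [setLIntegral_congr_fun measurableSet_Ioo fun t ht =>
    setLIntegral_congr_fun measurableSet_Ioo fun v hv => hR t ht v hv] at hfin
  have h := hray hfin
  calc ∫⁻ t in Ioo 0 δ, ∫⁻ v in Ioo 0 ε, ENNReal.ofReal t *
        (ENNReal.ofReal |Ri i (bpt z₁ P Q t v)| * m (bpt z₁ P Q t v))
      ≤ ∫⁻ t in Ioo 0 δ, ∫⁻ v in Ioo 0 ε, C * wt 0 0 s σ ω Λ' t v :=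
        setLIntegral_mono' measurableSet_Ioo fun t ht =>
          setLIntegral_mono' measurableSet_Ioo fun v hv => hRi i hi t ht v hv
    _ = C * ∫⁻ t in Ioo 0 δ, ∫⁻ v in Ioo 0 ε, wt 0 0 s σ ω Λ' t v := by
        rw [← lintegral_const_mul' _ _ hC]
        exact lintegral_congr fun t => lintegral_const_mul' _ _ hC
    _ < ∞ := ENNReal.mul_lt_top hC.lt_top h

end SepTwo

/-- **A thin sector inside the base polygon has finite mass as soon as its pieces are finite in
blown-up coordinates** (registered part of `stub_separateTwoPos_hI`; literal form of
`SepTwo.sector_finite`). -/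
theorem separateTwo_hiSector (Y : Set (Fin 2 → ℝ)) (m : (Fin 2 → ℝ) → ENNReal) (Ri : ℕ → (Fin 2 → ℝ) → ℝ) (N : ℕ) (z₁ P Q : Fin 2 → ℝ) (hY : MeasurableSet Y) (hm : Measurable m) (hRi : ∀ i, Measurable (Ri i)) (hdet : P 0 * Q 1 - Q 0 * P 1 ≠ 0) (δ ε : ℝ) (hin : ∀ t ∈ Set.Ioo (0 : ℝ) δ, ∀ v ∈ Set.Ioo (0 : ℝ) ε, (fun i => z₁ i + t * (P i + v * Q i)) ∈ Y) (hpieces : ∀ i ∈ Finset.range N, MeasureTheory.lintegral (MeasureTheory.volume.restrict (Set.Ioo 0 δ)) (fun t => MeasureTheory.lintegral (MeasureTheory.volume.restrict (Set.Ioo 0 ε)) (fun v => ENNReal.ofReal t * (ENNReal.ofReal |Ri i (fun i => z₁ i + t * (P i + v * Q i))| * m (fun i => z₁ i + t * (P i + v * Q i))))) < ⊤) : MeasureTheory.lintegral (MeasureTheory.volume.restrict ((fun w : Fin 2 → ℝ => z₁ + LinearMap.toContinuousLinearMap (Matrix.toLin' !![P 0, Q 0; P 1, Q 1]) w) '' {w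 : Fin 2 → ℝ | w 0 ∈ Set.Ioo 0 δ ∧ (w 1 - 0) / w 0 ∈ Set.Ico 0 ε})) (fun z => Y.indicator (fun x => (∑ i ∈ Finset.range N, ENNReal.ofReal |Ri i x|) * m x) z) < ⊤ := by
  exact SepTwo.sector_finite N z₁ P Q hY hm hRi hdet hin hpieces

end Summit.KontsevichZagierPeriods.ArrangementNormalForm.JanusBands
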